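import Summits.ABC.IUTFork.BrobergSzpiroBad
import Summits.ABC.IUTFork.BrobergCondP6
import Summits.ABC.IUTFork.Conditional.AbcOfSCor312OfBroberg
import HarnessLib

/-!
# Branch C — the quadratic BROBERG point `λ = (8−3√7)²(5−2√7)/(4−3√7)⁴ ∈ ℚ(√7)`: BOTH number-level readings of the typed
# [IUTchIII] Cor. 3.12 ⇒ [IUTchIV] Thm 1.10 passage — (U) `T.Cor312Of` and (P) `T.Cor312PerImageOf` — hold at EVERY genuine Θ-volume datum at
# EVERY prime level `l ≥ 5`, NO hypothesis: the whole Broberg `l`-axis in one kernel sentence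

C scoreboard (abc-iut-C-cert-3 gen 5, INTAKE / CERTS pen). PROOF-ONLY junction/glue file (no `def`, no new `Prop`, no instance, no notation;
nothing re-typed). Three inputs BY NAME, glued by `by_cases` on `l = 7`, `l = 11`:
* abc-iut-W-row-2 g6's `Broberg.cor312Of_of_szpiroGood` (p509160 «W:SZPIRO-BAD-BROBERG»: at every prime `l ≥ 5`, `l ∉ {7, 11}` the point is
  Szpiro-GOOD as typed, so reading (U) is an instance of abc-iut-c312-d1's `Cor22.ThetaVolumeDatumAt.cor312Of_of_szpiro`);
* THIS PEN's `Broberg.cor312Of_seven` / `Broberg.cor312Of_eleven` (p503174: at the two Szpiro-BAD levels reading (U) follows from abc-iut-W-row-2 g3's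
  unconditional licences p496949/p497044 through `GenuineK.cor312Of_of_licence` p435505 + the Θ-descent p447368 — NOT through the Szpiro route,
  `Broberg.not_szpiroGood_of_eq`);
* abc-iut-C-cert-2 g6's `Broberg.cor312PerImageOf_every` (p505746: reading (P) at every prime `l ≥ 5`, disc ℚ(√7) = 28 in kernel).
Non-emptiness of the datum type is a theorem at `l = 7, 11` (abc-iut-W-row-2 g5 p506230); at other levels it is NOT claimed here.

READING (numbers, no side): FINDINGS §T.4/§T.6 (C)/§T.7 (C) words extend BY NAME from «(P) at every level, (U) at 7/11» to «(U) AND (P) at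
every prime level l ≥ 5 over the Broberg point»; NO height bound follows (one known λ, log q ≪ the content locus); records UNCHANGED; (P6) and
Szpiro-badness are classical arithmetic; true-as-typed ≠ true-in-print; typed ≠ proved; instantiated ≠ endorsed; not a claim that abc is proved or
refuted; no side taken on [IUTchIII] Cor 3.12 / [IUTchIV] Thm 1.10 or on any author (Mochizuki / Scholze–Stix / Joshi / Dupuy–Hilado).
[cite: Mochizuki2012, IUTchIII Cor. 3.12 p. 173–174; IUTchIV Thm. 1.10 p. 22–23, Cor. 2.2 (ii) proof (P5)(P6)(P7) p. 45–46]
[claim: Mochizuki2012, status: disputed]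
-/

noncomputable section

open scoped Classical

namespace Summit.ABC.IUTFork.Conditional

open Literature.IUT.LogVolume Literature.IUT.LogVolume.Cor22
open Literature.NumberTheory.DiophantineGeometry Literature.NumberTheory.DiophantineGeometry.GenEll

/-- **Reading (U) on the WHOLE Broberg axis: for every prime `l ≥ 5` and every genuine Θ-volume datum `T` over `Broberg.point` at level `l`,
`T.Cor312Of` — NO hypothesis.** Szpiro-good levels by `Broberg.cor312Of_of_szpiroGood` (p509160), the two Szpiro-bad levels 7, 11 by
`Broberg.cor312Of_seven/_eleven` (p503174). [cite: Mochizuki2012, IUTchIII Cor. 3.12 p. 173–174; IUTchIV Cor. 2.2 (ii) proof (P5) p. 46]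
[claim: Mochizuki2012, status: disputed] -/
theorem Broberg.cor312Of_every {l : ℕ} (hl : l.Prime) (h5 : 5 ≤ l) (T : Cor22.ThetaVolumeDatumAt Broberg.point l) : T.Cor312Of := by
  by_cases h7 : l = 7
  · subst h7; exact Broberg.cor312Of_seven T
  by_cases h11 : l = 11
  · subst h11; exact Broberg.cor312Of_eleven T
  exact _root_.Summit.ABC.IUTFork.Broberg.cor312Of_of_szpiroGood hl h5 h7 h11 T

/-- **BOTH readings on the WHOLE Broberg axis: for every prime `l ≥ 5` and every genuine datum `T` over `Broberg.point`,
`T.Cor312Of ∧ T.Cor312PerImageOf` — NO hypothesis** (`Broberg.cor312Of_every` ∧ abc-iut-C-cert-2 g6's `Broberg.cor312PerImageOf_every` p505746).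
[cite: Mochizuki2012, IUTchIII Cor. 3.12 p. 173–174; IUTchIV Cor. 2.2 (ii) proof (P5) p. 46] [claim: Mochizuki2012, status: disputed] -/
theorem Broberg.cor312Of_and_cor312PerImageOf_every {l : ℕ} (hl : l.Prime) (h5 : 5 ≤ l)
    (T : Cor22.ThetaVolumeDatumAt Broberg.point l) : T.Cor312Of ∧ T.Cor312PerImageOf :=
  ⟨Broberg.cor312Of_every hl h5 T, _root_.Summit.ABC.IUTFork.Broberg.cor312PerImageOf_every hl h5 T⟩

/-- **Axis census form: every prime level `l ≥ 5` over Broberg's point is DECIDED in BOTH number-level readings (∀ T), and at the two tabulated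
(Szpiro-bad) levels 7, 11 the datum type is moreover INHABITED by theorem** (abc-iut-W-row-2 g5 `Broberg.nonempty_thetaVolumeDatumAt_seven/_eleven`
p506230), so there the sentence is witnessed: `∃ T, T.Cor312Of ∧ T.Cor312PerImageOf`. [cite: Mochizuki2012, IUTchIII Cor. 3.12 p. 173–174;
IUTchIV Cor. 2.2 (ii) proof (P6)(P7) p. 46] [claim: Mochizuki2012, status: disputed] -/
theorem Broberg.axis_decided_and_witnessed :
    (∀ l : ℕ, l.Prime → 5 ≤ l → ∀ T : Cor22.ThetaVolumeDatumAt Broberg.point l, T.Cor312Of ∧ T.Cor312PerImageOf) ∧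
      (∃ T : Cor22.ThetaVolumeDatumAt Broberg.point 7, T.Cor312Of ∧ T.Cor312PerImageOf) ∧
      (∃ T : Cor22.ThetaVolumeDatumAt Broberg.point 11, T.Cor312Of ∧ T.Cor312PerImageOf) := by
  refine ⟨fun l hl h5 T => Broberg.cor312Of_and_cor312PerImageOf_every hl h5 T, ?_, ?_⟩
  · obtain ⟨T⟩ := _root_.Summit.ABC.IUTFork.Broberg.nonempty_thetaVolumeDatumAt_seven
    exact ⟨T, Broberg.cor312Of_and_cor312PerImageOf_every (by norm_num) (by norm_num) T⟩
  · obtain ⟨T⟩ := _root_.Summit.ABC.IUTFork.Broberg.nonempty_thetaVolumeDatumAt_eleven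
    exact ⟨T, Broberg.cor312Of_and_cor312PerImageOf_every (by norm_num) (by norm_num) T⟩

end Summit.ABC.IUTFork.Conditional

end
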